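import Summits.Ventures.PackingBounds.Configurations.CliqueFrame
import Summits.Ventures.PackingBounds.Configurations.PetersenCode
import Summits.Ventures.PackingBounds.Configurations.D4NotUniversallyOptimal

/-!
# The Petersen code is the unique `10`-point `{1/6, -2/3}`-configuration in `ℝ⁴` (the `E`-series at `n = 4`)

Framing: lottery ticket; floor = certified bounds/negative ranges. Venture `PackingBounds` (cell
`pub-packcert`, seat `pub-packcert-energy`).

The clique-frame method of `Dim5Card16Unique` (`θ = 1/(10-n)`) at `n = 4`, `θ = 1/6`: **any two `10`-point sets of
unit vectors of `ℝ⁴` whose pairwise inner products lie in `{1/6, -2/3}` are isometric** (`isometric`) — they are the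
`(4, 10, 1/6)` Petersen code (`PetersenCode.exists_config`), and in particular have its energies (`energy_eq`).
Here no LP slackness is available (`A(4, arccos 1/6) = 10` is an SDP bound, Bachoc–Vallentin 2009; the value set is
the HYPOTHESIS), so the frame — four points pairwise at `1/6` — is found by a Ramsey argument instead of design
counting: the `-2/3`-graph is triangle-free (three unit vectors cannot be pairwise at `-2/3`), and a triangle-free
graph on `10 ≥ R(3,4) = 9` vertices has an independent `4`-set (`exists_frame`). Profiles against the frame then take
`#{j : ⟪z, a_j⟫ = -2/3} = 2` by the norm identity (`CliqueFrame.norm_identity`), `C` is the image of the fixed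
`4 + 6`-member family, and `CliqueFrame.isometric_of_frames` concludes. With an exactly tight three-point certificate
(Bachoc–Vallentin's) this would give the uniqueness of the optimal `(4, 10, 1/6)` code; the tree's kernel SDP row
`ThreePointCert.C4F` is floor-tight only, so that step is not claimed.

## References
* C. Bachoc, F. Vallentin, *Optimality and uniqueness of the (4,10,1/6) spherical code*, J. Combin. Theory Ser. A
  116 (2009) 195–204.
* J. H. Conway, N. J. A. Sloane, *SPLAG*, Ch. 9 Table 9.2. [`ConwaySloane1999`]
-/

noncomputable section

namespace Summit.Ventures.PackingBounds.Config.PetersenCodeUnique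

open Finset Module CliqueFrame

section config

variable {C : Finset (EuclideanSpace ℝ (Fin 4))} (h1 : ∀ x ∈ C, ‖x‖ = 1) (hN : C.card = 10)
  (hv : ∀ x ∈ C, ∀ y ∈ C, x ≠ y → inner ℝ x y = 1 / 6 ∨ inner ℝ x y = -2 / 3)
include h1 hN hv

omit hN in
/-- The `-2/3`-graph is triangle-free: two points at `-2/3` from a common point are at `1/6` from each other. -/
theorem inner_eq_sixth_of_neg {x y z : EuclideanSpace ℝ (Fin 4)} (hx : x ∈ C) (hy : y ∈ C) (hz : z ∈ C)
    (hxy : inner ℝ x y = -2 / 3) (hxz : inner ℝ x z = -2 / 3) (hyz : y ≠ z) : inner ℝ y z = 1 / 6 := by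
  rcases hv y hy z hz hyz with h | h
  · exact h
  · exfalso
    have hnn : 0 ≤ ‖x + y + z‖ ^ 2 := sq_nonneg _
    rw [← real_inner_self_eq_norm_sq] at hnn
    simp only [inner_add_left, inner_add_right, real_inner_self_eq_norm_sq, h1 x hx, h1 y hy, h1 z hz] at hnn
    linarith [real_inner_comm x y, real_inner_comm x z, real_inner_comm y z]

omit h1 hN in
/-- Two distinct points NOT at `-2/3` are at `1/6`. -/
theorem inner_eq_sixth_of_ne {y z : EuclideanSpace ℝ (Fin 4)} (hy : y ∈ C) (hz : z ∈ C) (hyz : y ≠ z)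
    (h : inner ℝ y z ≠ -2 / 3) : inner ℝ y z = 1 / 6 :=
  (hv y hy z hz hyz).resolve_right h

/-- **Ramsey step**: there are four points of `C` pairwise at inner product `1/6`. -/
theorem exists_four : ∃ S : Finset (EuclideanSpace ℝ (Fin 4)), S ⊆ C ∧ S.card = 4 ∧
    ∀ y ∈ S, ∀ z ∈ S, y ≠ z → inner ℝ y z = 1 / 6 := by
  classical
  by_cases hA : ∃ v ∈ C, 4 ≤ (C.filter fun w => inner ℝ v w = -2 / 3).card
  · -- a vertex of degree `≥ 4`: its neighbourhood is independent
    obtain ⟨v, hv0, hdeg⟩ := hA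
    obtain ⟨S, hS, hScard⟩ := Finset.exists_subset_card_eq hdeg
    refine ⟨S, fun y hy => (mem_filter.mp (hS hy)).1, hScard, fun y hy z hz hyz => ?_⟩
    exact inner_eq_sixth_of_neg h1 hv hv0 (mem_filter.mp (hS hy)).1 (mem_filter.mp (hS hz)).1
      (mem_filter.mp (hS hy)).2 (mem_filter.mp (hS hz)).2 hyz
  · -- all degrees `≤ 3`
    push Not at hA
    have hdeg : ∀ v ∈ C, (C.filter fun w => inner ℝ v w = -2 / 3).card ≤ 3 := fun v hv0 =>
      Nat.lt_succ_iff.mp (hA v hv0)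
    have hne : C.Nonempty := by rw [← Finset.card_pos, hN]; norm_num
    obtain ⟨v, hv0⟩ := hne
    -- non-neighbours of `v`
    set M := (C.erase v).filter fun w => inner ℝ v w ≠ -2 / 3 with hM
    have hMsub : ∀ w ∈ M, w ∈ C ∧ w ≠ v ∧ inner ℝ v w = 1 / 6 := fun w hw => by
      obtain ⟨hw1, hw2⟩ := mem_filter.mp hw
      exact ⟨mem_of_mem_erase hw1, ne_of_mem_erase hw1,
        inner_eq_sixth_of_ne hv hv0 (mem_of_mem_erase hw1) (ne_of_mem_erase hw1).symm hw2⟩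
    have hMcard : 6 ≤ M.card := by
      have hcov : C.erase v ⊆ M ∪ C.filter fun w => inner ℝ v w = -2 / 3 := by
        intro w hw
        by_cases h : inner ℝ v w = -2 / 3
        · exact mem_union_right _ (mem_filter.mpr ⟨mem_of_mem_erase hw, h⟩)
        · exact mem_union_left _ (mem_filter.mpr ⟨hw, h⟩)
      have h9 : (C.erase v).card = 9 := by rw [card_erase_of_mem hv0, hN]
      have := (card_le_card hcov).trans (card_union_le _ _)
      have hd := hdeg v hv0
      omega
    have hMne : M.Nonempty := by rw [← Finset.card_pos]; omega
    obtain ⟨u, hu⟩ := hMne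
    obtain ⟨huC, huv, hvu⟩ := hMsub u hu
    set Nu := M.filter fun w => inner ℝ u w = -2 / 3 with hNu
    by_cases hB : 3 ≤ Nu.card
    · -- three neighbours of `u` inside `M`: independent, together with `v`
      obtain ⟨S₃, hS₃, hS₃card⟩ := Finset.exists_subset_card_eq hB
      have hS₃M : ∀ w ∈ S₃, w ∈ M ∧ inner ℝ u w = -2 / 3 := fun w hw => mem_filter.mp (hS₃ hw)
      have hvS₃ : v ∉ S₃ := fun h => (hMsub v (hS₃M v h).1).2.1 rfl
      refine ⟨insert v S₃, ?_, by rw [card_insert_of_notMem hvS₃, hS₃card], ?_⟩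
      · intro y hy
        rcases mem_insert.mp hy with rfl | hy
        · exact hv0
        · exact (hMsub y (hS₃M y hy).1).1
      · intro y hy z hz hyz
        rcases mem_insert.mp hy with rfl | hy'
        · rcases mem_insert.mp hz with rfl | hz'
          · exact absurd rfl hyz
          · exact (hMsub z (hS₃M z hz').1).2.2
        · rcases mem_insert.mp hz with rfl | hz'
          · rw [real_inner_comm]; exact (hMsub y (hS₃M y hy').1).2.2
          · exact inner_eq_sixth_of_neg h1 hv huC (hMsub y (hS₃M y hy').1).1 (hMsub z (hS₃M z hz').1).1
              (hS₃M y hy').2 (hS₃M z hz').2 hyz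
    · -- `u` has `≤ 2` neighbours in `M`: three non-neighbours of `u` in `M`, two of them non-adjacent
      push Not at hB
      set M' := (M.erase u).filter fun w => inner ℝ u w ≠ -2 / 3 with hM'
      have hM'sub : ∀ w ∈ M', w ∈ M ∧ w ≠ u ∧ inner ℝ u w = 1 / 6 := fun w hw => by
        obtain ⟨hw1, hw2⟩ := mem_filter.mp hw
        exact ⟨mem_of_mem_erase hw1, ne_of_mem_erase hw1,
          inner_eq_sixth_of_ne hv huC (hMsub w (mem_of_mem_erase hw1)).1 (ne_of_mem_erase hw1).symm hw2⟩
      have hM'card : 3 ≤ M'.card := by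
        have hcov : M.erase u ⊆ M' ∪ Nu := by
          intro w hw
          by_cases h : inner ℝ u w = -2 / 3
          · exact mem_union_right _ (mem_filter.mpr ⟨mem_of_mem_erase hw, h⟩)
          · exact mem_union_left _ (mem_filter.mpr ⟨hw, h⟩)
        have h5 : 5 ≤ (M.erase u).card := by rw [card_erase_of_mem hu]; omega
        have := (card_le_card hcov).trans (card_union_le _ _)
        omega
      obtain ⟨T, hT, hTcard⟩ := Finset.exists_subset_card_eq hM'card
      obtain ⟨y, z, w, hyz, hyw, hzw, hT3⟩ := Finset.card_eq_three.mp hTcard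
      have hy := hM'sub y (hT (by rw [hT3]; simp))
      have hz := hM'sub z (hT (by rw [hT3]; simp))
      have hw := hM'sub w (hT (by rw [hT3]; simp))
      -- two of `y, z, w` are at `1/6`
      have hpair : ∃ p q : EuclideanSpace ℝ (Fin 4), p ∈ M' ∧ q ∈ M' ∧ p ≠ q ∧ inner ℝ p q = 1 / 6 := by
        by_cases hyz' : inner ℝ y z = -2 / 3
        · by_cases hyw' : inner ℝ y w = -2 / 3
          · exact ⟨z, w, hT (by rw [hT3]; simp), hT (by rw [hT3]; simp), hzw,
              inner_eq_sixth_of_neg h1 hv (hMsub y hy.1).1 (hMsub z hz.1).1 (hMsub w hw.1).1 hyz' hyw' hzw⟩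
          · exact ⟨y, w, hT (by rw [hT3]; simp), hT (by rw [hT3]; simp), hyw,
              inner_eq_sixth_of_ne hv (hMsub y hy.1).1 (hMsub w hw.1).1 hyw hyw'⟩
        · exact ⟨y, z, hT (by rw [hT3]; simp), hT (by rw [hT3]; simp), hyz,
            inner_eq_sixth_of_ne hv (hMsub y hy.1).1 (hMsub z hz.1).1 hyz hyz'⟩
      obtain ⟨p, q, hp, hq, hpq, hipq⟩ := hpair
      obtain ⟨hpM, hpu, hup⟩ := hM'sub p hp
      obtain ⟨hqM, hqu, huq⟩ := hM'sub q hq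
      obtain ⟨hpC, hpv, hvp⟩ := hMsub p hpM
      obtain ⟨hqC, hqv, hvq⟩ := hMsub q hqM
      have hcard4 : ({v, u, p, q} : Finset (EuclideanSpace ℝ (Fin 4))).card = 4 := by
        rw [card_insert_of_notMem, card_insert_of_notMem, card_pair hpq]
        · simp only [mem_insert, mem_singleton, not_or]; exact ⟨hpu.symm, hqu.symm⟩
        · simp only [mem_insert, mem_singleton, not_or]; exact ⟨huv.symm, hpv.symm, hqv.symm⟩
      refine ⟨{v, u, p, q}, ?_, hcard4, ?_⟩
      · intro y hy
        simp only [mem_insert, mem_singleton] at hy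
        rcases hy with rfl | rfl | rfl | rfl
        exacts [hv0, huC, hpC, hqC]
      · intro a ha b hb hab
        simp only [mem_insert, mem_singleton] at ha hb
        rcases ha with rfl | rfl | rfl | rfl <;> rcases hb with rfl | rfl | rfl | rfl <;>
          first
          | exact absurd rfl hab
          | assumption
          | (rw [real_inner_comm]; assumption)

/-- **The frame.** `C` contains four points pairwise at inner product `1/6`. -/
theorem exists_frame : ∃ a : Fin 4 → EuclideanSpace ℝ (Fin 4), (∀ i, a i ∈ C) ∧
    ∀ i j, inner ℝ (a i) (a j) = if i = j then 1 else 1 / 6 := by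
  classical
  obtain ⟨S, hSC, hScard, hS⟩ := exists_four h1 hN hv
  have hcard : Fintype.card S = 4 := by rw [Fintype.card_coe, hScard]
  let e : S ≃ Fin 4 := Fintype.equivFinOfCardEq hcard
  refine ⟨fun i => ((e.symm i : S) : EuclideanSpace ℝ (Fin 4)), fun i => hSC (e.symm i).2, ?_⟩
  intro i j
  by_cases hij : i = j
  · subst hij
    rw [if_pos rfl, real_inner_self_eq_norm_sq, h1 _ (hSC (e.symm i).2), one_pow]
  · rw [if_neg hij]
    have hne : ((e.symm i : S) : EuclideanSpace ℝ (Fin 4)) ≠ (e.symm j : S) := by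
      intro h
      exact hij (e.symm.injective (Subtype.ext h))
    exact hS _ (e.symm i).2 _ (e.symm j).2 hne

end config

/-! ### Index data of the family and the profile of a point -/

/-- Index set of the `10`-point family: frame vectors (`{k}`, coefficient `0`) and the six points
`Σ_{j ∈ T} aⱼ - (2/3)σ`, `|T| = 2` (`σ = Σ aⱼ`). -/
abbrev Idx : Type := Fin 4 ⊕ {T : Finset (Fin 4) // T.card = 2}

/-- The subset of the frame entering the member of the family. -/
def setOf : Idx → Finset (Fin 4)
  | Sum.inl k => {k}
  | Sum.inr T => T.1

/-- The coefficient of `σ = Σ aⱼ` subtracted in the member of the family. -/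
def coefOf : Idx → ℝ
  | Sum.inl _ => 0
  | Sum.inr _ => 2 / 3

/-- The index set has `10 = 4 + 6` elements. -/
theorem card_Idx : Fintype.card Idx = 10 := by
  simp only [Idx, Fintype.card_sum, Fintype.card_fin]
  rfl

/-- `fam a T c` as a single sum of multiples of the frame. -/
private theorem fam_eq_sum {a : Fin 4 → EuclideanSpace ℝ (Fin 4)} (T : Finset (Fin 4)) (c : ℝ) :
    fam a T c = ∑ j, ((if j ∈ T then (1 : ℝ) else 0) - c) • a j := by
  classical
  simp only [fam, sub_smul, Finset.sum_sub_distrib, ite_smul, one_smul, zero_smul, Finset.sum_ite_mem,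
    Finset.univ_inter, Finset.smul_sum]

section profile

variable {C : Finset (EuclideanSpace ℝ (Fin 4))} (h1 : ∀ x ∈ C, ‖x‖ = 1) (hN : C.card = 10)
  (hv : ∀ x ∈ C, ∀ y ∈ C, x ≠ y → inner ℝ x y = 1 / 6 ∨ inner ℝ x y = -2 / 3)
  {a : Fin 4 → EuclideanSpace ℝ (Fin 4)} (ha : ∀ i, a i ∈ C)
  (hG : ∀ i j, inner ℝ (a i) (a j) = if i = j then 1 else 1 / 6)
include h1 hN hv ha hG

omit hN in
/-- **Every point of `C` is a member of the fixed family over the frame.** -/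
theorem exists_index {z : EuclideanSpace ℝ (Fin 4)} (hz : z ∈ C) :
    ∃ x : Idx, z = fam a (setOf x) (coefOf x) := by
  classical
  by_cases hza : ∃ k, z = a k
  · obtain ⟨k, rfl⟩ := hza
    exact ⟨Sum.inl k, (fam_singleton_zero a k).symm⟩
  push Not at hza
  have hb : ∀ k, inner ℝ z (a k) = 1 / 6 ∨ inner ℝ z (a k) = -2 / 3 := fun k => hv z hz (a k) (ha k) (hza k)
  have hcard : Fintype.card (Fin 4) = finrank ℝ (EuclideanSpace ℝ (Fin 4)) := by simp
  have hrepr := repr_formula hG (by norm_num) (by norm_num) hcard z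
  have hnorm := norm_identity hG (by norm_num) (by norm_num) hcard z
  have hs1 := sum_comp_two_values (fun k => inner ℝ z (a k)) hb (fun t => t)
  have hs2 := sum_comp_two_values (fun k => inner ℝ z (a k)) hb (fun t => t ^ 2)
  set S := univ.filter fun k => inner ℝ z (a k) = -2 / 3 with hS
  simp only [Fintype.card_fin, Nat.cast_ofNat] at hrepr hnorm hs1 hs2
  rw [h1 z hz, hs1, hs2] at hnorm
  have hsle : S.card ≤ 4 := by
    have := Finset.card_le_univ S; simpa using this
  -- the norm identity: `(|S| - 2)(|S| - 5) = 0`, and `|S| ≤ 4`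
  have hs : S.card = 2 := by
    have hq : ((S.card : ℝ) - 2) * ((S.card : ℝ) - 5) = 0 := by nlinarith [hnorm]
    have hsle' : (S.card : ℝ) ≤ 4 := by exact_mod_cast hsle
    rcases mul_eq_zero.mp hq with h | h
    · exact_mod_cast (by linarith : (S.card : ℝ) = 2)
    · exfalso; linarith
  have hcoef : ∀ j, (inner ℝ z (a j) - 1 / 6 * (∑ i, inner ℝ z (a i)) / (1 + (4 - 1) * (1 / 6))) / (1 - 1 / 6)
      = (if j ∈ univ \ S then (1 : ℝ) else 0) - (8 - (S.card : ℝ)) / 9 := by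
    intro j
    rw [hs1]
    by_cases hj : inner ℝ z (a j) = -2 / 3
    · have hjS : j ∈ S := mem_filter.mpr ⟨mem_univ j, hj⟩
      rw [if_neg (fun h => (mem_sdiff.mp h).2 hjS), hj]
      ring
    · have hjS : j ∉ S := fun h => hj (mem_filter.mp h).2
      rw [if_pos (mem_sdiff.mpr ⟨mem_univ j, hjS⟩), (hb j).resolve_right hj]
      ring
  have hz' : z = fam a (univ \ S) ((8 - (S.card : ℝ)) / 9) := by
    rw [fam_eq_sum]
    conv_lhs => rw [hrepr]
    exact Finset.sum_congr rfl fun j _ => by rw [hcoef j]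
  have hT : (univ \ S).card = 2 := by rw [Finset.card_univ_sdiff, Fintype.card_fin, hs]
  refine ⟨Sum.inr ⟨univ \ S, hT⟩, ?_⟩
  rw [hz', setOf, coefOf, hs]
  norm_num

/-- **`C` is the image of the fixed family over the frame.** -/
theorem eq_image : C = univ.image fun x : Idx => fam a (setOf x) (coefOf x) := by
  classical
  exact eq_image_of_forall_exists C _ (fun z hz => exists_index h1 hv ha hG hz) (by rw [card_Idx, hN])

end profile

/-! ### Uniqueness -/

/-- **Uniqueness of the `10`-point `{1/6, -2/3}`-configurations in `ℝ⁴`**: any two are isometric (both are the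
Petersen code). [cite: ConwaySloane1999, Ch. 9 Table 9.2] -/
theorem isometric {C C' : Finset (EuclideanSpace ℝ (Fin 4))} (h1 : ∀ x ∈ C, ‖x‖ = 1) (hN : C.card = 10)
    (hv : ∀ x ∈ C, ∀ y ∈ C, x ≠ y → inner ℝ x y = 1 / 6 ∨ inner ℝ x y = -2 / 3)
    (h1' : ∀ x ∈ C', ‖x‖ = 1) (hN' : C'.card = 10)
    (hv' : ∀ x ∈ C', ∀ y ∈ C', x ≠ y → inner ℝ x y = 1 / 6 ∨ inner ℝ x y = -2 / 3) :
    ∃ Ψ : EuclideanSpace ℝ (Fin 4) ≃ₗᵢ[ℝ] EuclideanSpace ℝ (Fin 4), C' = C.image Ψ := by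
  classical
  obtain ⟨a, ha, hG⟩ := exists_frame h1 hN hv
  obtain ⟨a', ha', hG'⟩ := exists_frame h1' hN' hv'
  exact isometric_of_frames setOf coefOf hG hG' (eq_image h1 hN hv ha hG) (eq_image h1' hN' hv' ha' hG')

/-- **Such a configuration has the Petersen code's energies**: for every pair potential `a`,
`Σ_{x ≠ y} a(⟪x,y⟫) = 10 (3 a(-2/3) + 6 a(1/6))` (i.e. `3` neighbours at `-2/3` and `6` at `1/6` around every point on
average; in fact `C` is an isometric image of the configuration of `PetersenCode.exists_config`). -/
theorem energy_eq {C : Finset (EuclideanSpace ℝ (Fin 4))} (h1 : ∀ x ∈ C, ‖x‖ = 1) (hN : C.card = 10)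
    (hv : ∀ x ∈ C, ∀ y ∈ C, x ≠ y → inner ℝ x y = 1 / 6 ∨ inner ℝ x y = -2 / 3) (a : ℝ → ℝ) :
    ∑ x ∈ C, ∑ y ∈ C.erase x, a (inner ℝ x y) = (10 : ℝ) * (3 * a (-2 / 3) + 6 * a (1 / 6)) := by
  classical
  obtain ⟨P, hPcard, hP1, hPle, hPE⟩ := PetersenCode.exists_config
  -- the Petersen configuration has inner products in `{1/6, -2/3}`: read off its energy with an indicator potential
  have hPv : ∀ x ∈ P, ∀ y ∈ P, x ≠ y → inner ℝ x y = 1 / 6 ∨ inner ℝ x y = -2 / 3 := by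
    set ind : ℝ → ℝ := fun t => if (t = 1 / 6 ∨ t = -2 / 3) then 0 else 1 with hind
    have hE := hPE ind
    have hval : ind (-2 / 3) = 0 ∧ ind (1 / 6) = 0 := by
      refine ⟨?_, ?_⟩ <;> simp [hind]
    rw [hval.1, hval.2] at hE
    norm_num at hE
    have hnn : ∀ x ∈ P, ∀ y ∈ P.erase x, 0 ≤ ind (inner ℝ x y) := by
      intro x _ y _; simp only [hind]; split_ifs <;> norm_num
    intro x hx y hy hxy
    have hx0 := (Finset.sum_eq_zero_iff_of_nonneg fun x hx => Finset.sum_nonneg fun y hy => hnn x hx y hy).mp hE x hx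
    have h0 := (Finset.sum_eq_zero_iff_of_nonneg fun y hy => hnn x hx y hy).mp hx0 y
      (Finset.mem_erase.mpr ⟨hxy.symm, hy⟩)
    simp only [hind] at h0
    by_contra hc
    rw [if_neg hc] at h0
    exact one_ne_zero h0
  obtain ⟨Ψ, hΨ⟩ := isometric hP1 hPcard hPv h1 hN hv
  rw [hΨ, energy_image_linearIsometryEquiv, hPE]

end Summit.Ventures.PackingBounds.Config.PetersenCodeUnique

end
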